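import Summits.HodgeConjecture.HodgeConjecture.Theorems.H413TowerRealisation
import Summits.HodgeConjecture.HodgeConjecture.Theorems.F0P3TowerGlue
import HarnessLib

/-!
# FLOOR-0 P2 ∕ P3 ∕ P4 — the Matsushima–Hodge realisation of the tower AT THE GLUE: the levelwise holomorphic realisation system of
# record (harmonic pull-backs of the component classes) and the records-generic existence theorem

Cell hodgecm-mathlib (D-0151), FLOOR 0, crux item H413 = stmt-HodgeConjecture-24833.  Author F0P2-p04 (g0) (programme P2, seat U1′; joint desk with
P3-S1 (F0P3-p01 (g0)) ∕ P4-T2′: bus `F0/P2/STATUS.md`, `F0/P3/STATUS.md` 2026-08-30T21:54Z–22:10Z).  `--supports stmt-HodgeConjecture-24833 --as helper`.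
HC_CM is proved only modulo the 7 printed citations until rung 0 closes; this file proves nothing about them.

INPUTS BY NAME.  ★ `Theorems/H413TowerRealisation` (this seat): from a levelwise holomorphic realisation system `ρ` with `IsSystem ρ` ((R1) `restrict`,
(R2) `translate`, (R3) `mem`, (R4) `injective`) the realisation `realT : Tower … V →ₗ[ℂ] (U(V)(𝔸_{F⁺}) → ℂ²)` — injective, `cohForms 𝔞₀`-valued,
`act`-equivariant (`exists_realisation_of_system`).  ★ `Theorems/F0P3TowerGlue` (F0P3-p01 (g0)): the GLUED FUNCTION `CuspCot.glue … hV hΓ c` of a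
level family in the P0 currency `adelicDatum F V` — `glue c x = (levelPull (Γ.conj x_f) (c x_f)) (x_{ι₁})` — with, for `(1,0)`-families `c ∈ H10L Γ hΓ`,
exactly the four properties (R1) `glue_restrictLevel`, (R2) `glue_translate`, (R3) `glue_mem_holCotForms`, (R4) `eq_zero_of_glue_eq_zero`.

THIS FILE.  §1 `glueSystem … hV Γ hΓ := glueLin … hV hΓ ∘ₗ (H10L … Γ hΓ).subtype` IS a levelwise holomorphic realisation system
(`isSystem_glueSystem`); §2 **`exists_realisation`**: for every hermitian space `V` in the anisotropic regime and all universe records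
`hHD hI h₁ h₃ hA` there is an INJECTIVE `ℂ`-linear `r : Tower … V →ₗ[ℂ] (U(V)(𝔸_{F⁺}) → ℂ²)` with values in `cohForms (archFactorOf F V)` and
`r (towerRep g x) = rightRep F V g (r x)` — the common body of P2's `StubU1RealisationAt` and P3's `StubS1HodgeMatsushimaDecAt` before the pin is
inserted (the pin closers: `Theorems/P2StubU1RealisationAt` (this seat), `Theorems/F0P3StubS1Dec` (F0P3-p01)); `realT_glueSystem_ofLevel` spells the
realisation of a level family: `glue (π c) + conj (glue (π (conj c)))`.
[cite: BorelWallach2000, VII 2.10, VII 3.2, XIII 1.2] [cite: VoisinHodgeI2002, §7.1.1 Cor. 7.6] [cite: Borel1997, §5.14]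

## References
* [BorelWallach2000] A. Borel, N. Wallach, 2nd ed., AMS 2000, VII 2.10, VII 3.2 (Matsushima), XIII 1.2 (adelic pieces).
* [VoisinHodgeI2002] C. Voisin, *Hodge Theory and Complex Algebraic Geometry I*, CUP 2002, §7.1.1 Cor. 7.6.  * [Borel1997] A. Borel, §5.14.
* Tree: ★ `Theorems/H413TowerRealisation` (`IsSystem`, `realT`, `exists_realisation_of_system`), ★ `Theorems/F0P3TowerGlue` (`CuspCot.glue`, `glueLin`,
  `glue_restrictLevel`, `glue_translate`, `glue_mem_holCotForms`, `eq_zero_of_glue_eq_zero`), ★ `Theorems/H413TowerConj` (`H10L`, `conjL`),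
  HodgeCM `Model/TowerCarrier` (`Tower`, `ofLevel`, `towerRep`).
-/

set_option autoImplicit false
set_option linter.dupNamespace false

noncomputable section

open Function Set
open Literature.AlgebraicGeometry.ShimuraVarieties
open Literature.AlgebraicGeometry.HodgeTheory
open Literature.NumberTheory.Automorphic
open Literature.NumberTheory.Automorphic.PicardCM
open Literature.NumberTheory.Transcendental (Arapura2012_Cor_15_4_6)
open HodgeCM HodgeCM.Model HodgeCM.Model.TowerLevel HodgeCM.Model.TowerCarrier
open Summit.HodgeConjecture.HodgeConjecture.Cruxes.H413.CohFormsCarriers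
open Summit.HodgeConjecture.HodgeConjecture.Cruxes.H413.TowerConj

namespace Summit.HodgeConjecture.HodgeConjecture.Cruxes.H413.TowerRealisation

variable (hHD : exists_isReal_hodgeModel) (hI : hodgePQ_independent_of_hodgeModel)
  (h₁ : BallQuotientUniformised) (h₃ : CMAbelianVarietyRealised) (hA : Arapura2012_Cor_15_4_6)
variable {F : CMField} {ι₁ : F →+* ℂ} {V : HermSpace3 F ι₁} (hV : IsAnisotropic F (HodgeCM.HermSpace3.Hm V))

/-! ## §1 The glue system is a levelwise holomorphic realisation system -/

/-- **The levelwise holomorphic realisation system OF RECORD**: on the `(1,0)`-families of level `Γ`, F0P3-p01's glued function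
`glueLin … hV hΓ` (harmonic pull-backs of the component classes, read at the `U(2,1)`-coordinate) restricted along `H10L Γ hΓ ≤ towerLevel Γ hΓ`.
[cite: BorelWallach2000, XIII 1.2] [cite: Borel1997, §5.14] -/
def glueSystem (Γ : Level V) (hΓ : Γ.BelowConjThree) :
    ↥(H10L hHD hI (ballQuotientUniformisedDatum_of h₁) h₃ hA Γ hΓ) →ₗ[ℂ] ((adelicDatum F V).Adelic → (Fin 2 → ℂ)) :=
  (CuspCot.glueLin hHD hI h₁ h₃ hA hV hΓ).comp (H10L hHD hI (ballQuotientUniformisedDatum_of h₁) h₃ hA Γ hΓ).subtype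

/-- Unfolding `glueSystem`: `glueSystem a = glue ↑a`. [cite: BorelWallach2000, XIII 1.2] -/
@[simp] theorem glueSystem_apply {Γ : Level V} (hΓ : Γ.BelowConjThree) (a : ↥(H10L hHD hI (ballQuotientUniformisedDatum_of h₁) h₃ hA Γ hΓ)) :
    glueSystem hHD hI h₁ h₃ hA hV Γ hΓ a =
      CuspCot.glue hHD hI h₁ h₃ hV hΓ
        ((a : towerLevel hHD hI (ballQuotientUniformisedDatum_of h₁) h₃ hA Γ hΓ) :
          Π h, W hHD hI (ballQuotientUniformisedDatum_of h₁) h₃ Γ hΓ h) := rfl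

/-- **The glue system satisfies (R1)–(R4)** — verbatim F0P3-p01's `glue_restrictLevel`, `glue_translate`, `glue_mem_holCotForms`,
`eq_zero_of_glue_eq_zero`. [cite: BorelWallach2000, VII 3.2 and XIII 1.2] [cite: VoisinHodgeI2002, §7.1.1 Cor. 7.6] -/
theorem isSystem_glueSystem : IsSystem hHD hI (ballQuotientUniformisedDatum_of h₁) h₃ hA (glueSystem hHD hI h₁ h₃ hA hV) where
  restrict Γ Γ' hle hΓ hΓ' a := by
    rw [glueSystem_apply, glueSystem_apply]
    exact CuspCot.glue_restrictLevel hHD hI h₁ h₃ hA hV hle hΓ hΓ' _ a.2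
  translate Γ hΓ g a := by
    rw [glueSystem_apply, glueSystem_apply]
    exact CuspCot.glue_translate hHD hI h₁ h₃ hA hV hΓ g _ a.2
  mem Γ hΓ a := by
    rw [glueSystem_apply]
    exact CuspCot.glue_mem_holCotForms hHD hI h₁ h₃ hA hV _ a.2
  injective Γ hΓ := by
    refine (injective_iff_map_eq_zero _).mpr fun a ha ↦ ?_
    rw [glueSystem_apply] at ha
    exact Subtype.ext (CuspCot.eq_zero_of_glue_eq_zero hHD hI h₁ h₃ hA hV _ a.2 ha)

/-! ## §2 The realisation of the tower of record and the records-generic existence theorem -/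

/-- **The realisation of a level family, spelled out**: `realT (ofLevel Γ c) = glue (π c) + conj (glue (π (conj c)))`.
[cite: BorelWallach2000, VII 2.10 and XIII 1.2] -/
theorem realT_glueSystem_ofLevel {Γ : Level V} (hΓ : Γ.BelowConjThree)
    (c : towerLevel hHD hI (ballQuotientUniformisedDatum_of h₁) h₃ hA Γ hΓ) :
    realT hHD hI (ballQuotientUniformisedDatum_of h₁) h₃ hA (isSystem_glueSystem hHD hI h₁ h₃ hA hV)
        (ofLevel hHD hI (ballQuotientUniformisedDatum_of h₁) h₃ hA Γ hΓ c) =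
      CuspCot.glue hHD hI h₁ h₃ hV hΓ
          ((projL hHD hI (ballQuotientUniformisedDatum_of h₁) h₃ hA Γ hΓ c :
              towerLevel hHD hI (ballQuotientUniformisedDatum_of h₁) h₃ hA Γ hΓ) :
            Π h, W hHD hI (ballQuotientUniformisedDatum_of h₁) h₃ Γ hΓ h) +
        conjFun F V (CuspCot.glue hHD hI h₁ h₃ hV hΓ
          ((projL hHD hI (ballQuotientUniformisedDatum_of h₁) h₃ hA Γ hΓ (conjL hHD hI (ballQuotientUniformisedDatum_of h₁) h₃ hA Γ hΓ c) :
              towerLevel hHD hI (ballQuotientUniformisedDatum_of h₁) h₃ hA Γ hΓ) :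
            Π h, W hHD hI (ballQuotientUniformisedDatum_of h₁) h₃ Γ hΓ h)) := by
  rw [realT_ofLevel, realL_apply, glueSystem_apply, glueSystem_apply, coe_holPart, coe_holPart]

/-- **THE MATSUSHIMA–HODGE REALISATION OF THE PIN'S TOWER (records-generic)**: for the universe records `hHD hI h₁ h₃ hA` and a hermitian
space `V` in the anisotropic regime there is an INJECTIVE `ℂ`-linear map `r : H = colim_K H¹(X_K(ℂ); ℂ) → (U(V)(𝔸_{F⁺}) → ℂ²)` with values in the
`(1,0) ⊕ (0,1)` cotangent automorphic forms `cohForms (archFactorOf F V)` of the factor of record, intertwining binder-1's Hecke action `towerRep`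
with the finite-adelic right translation `rightRep F V`.  (The INVERSE direction of P4's class map; with ★ `StubT2MatsushimaHodgeAt` the class map
is a `U(V)(𝔸_{F⁺,f})`-equivariant isomorphism `cohForms 𝔞₀ ≅ H¹_B`.) [cite: BorelWallach2000, VII 3.2, VII 3.6, XIII 1.2]
[cite: VoisinHodgeI2002, §6.1.3 Cor. 6.12; §7.1.1 Cor. 7.6] [cite: Borel1997, §5.14] -/
theorem exists_realisation (hV : IsAnisotropic F (HodgeCM.HermSpace3.Hm V)) :
    ∃ r : Tower hHD hI (ballQuotientUniformisedDatum_of h₁) h₃ hA V →ₗ[ℂ] ((adelicDatum F V).Adelic → (Fin 2 → ℂ)),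
      Function.Injective r ∧ (∀ x, r x ∈ cohForms (archFactorOf F V)) ∧
        ∀ (g : V.adelicFin) (x : Tower hHD hI (ballQuotientUniformisedDatum_of h₁) h₃ hA V),
          r (towerRep hHD hI (ballQuotientUniformisedDatum_of h₁) h₃ hA V g x) = rightRep F V g (r x) :=
  exists_realisation_of_system hHD hI (ballQuotientUniformisedDatum_of h₁) h₃ hA (glueSystem hHD hI h₁ h₃ hA hV)
    (isSystem_glueSystem hHD hI h₁ h₃ hA hV)

end Summit.HodgeConjecture.HodgeConjecture.Cruxes.H413.TowerRealisation

end
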